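import Summits.ResolutionOfSingularities.ResolutionOfSingularities.Theorems.MarkedTransferCampaignW46MohWindowShadeTerminalCentresExit
import Summits.ResolutionOfSingularities.ResolutionOfSingularities.Theorems.MarkedTransferCampaignW46MohWindowShadeFixedPoint
import Summits.ResolutionOfSingularities.ResolutionOfSingularities.Theorems.MarkedTransferCampaignW46MohWindowShadeNoInvariant
import Summits.ResolutionOfSingularities.ResolutionOfSingularities.Theorems.MarkedTransferCampaignW46MohWindowShadeExitStatement

/-!
# [OURS · L1 W4.6] Rung (iii) "Moh window" for the classical pair — the three v2 OURS predicates of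
  `MarkedTransferCampaignW46MohWindowShadeExitStatement.lean` HOLD (closers by name)

Cell `res-hironaka`, rung L, slot W4.6, seat `res-L1-s46-pv-6` (gen 2).  One-line closers onto
`MarkedTransferCampaignW46MohWindowShadeTerminalCentres.lean` (p485868), `…TerminalCentresExit.lean`
(p486590) and `…FixedPoint.lean` (p486610): `CampaignW46MohWindowShadeTerminalCentreStable` and
`CampaignW46MohWindowShadeTerminalCentreTerminates` hold for every prime `p`, every field `K` of
characteristic `p`, every finite `σ`; `CampaignW46MohWindowShadeFixedPointInWindow` holds for every
field of characteristic `2`.  OURS; NOT statements of the manuscript [claim: Hironaka2017, status: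
under-review], nothing of which is used.  AI review is weaker than expert review.
-/

noncomputable section

set_option linter.dupNamespace false -- mandated namespace of this single-conjunct summit

namespace Summit.ResolutionOfSingularities.ResolutionOfSingularities.Theorems

open Literature.AlgebraicGeometry.Resolution
open Literature.AlgebraicGeometry.Resolution.Hauser2010

section Centres

variable (p : ℕ) [Fact p.Prime] (K : Type*) [Field K] [DecidableEq K] [CharP K p]
variable (σ : Type*) [Fintype σ] [DecidableEq σ]

omit [Fact p.Prime] in
/-- **[OURS · L1 W4.6] `CampaignW46MohWindowShadeTerminalCentreStable` holds** (closer; proofs =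
`CampaignW46.MohWindowShadeTerminalCentres.ordZero_step_eq`, `shade_step_eq_zero`,
`isEquimultiplePoint_iff`, `degree_step_r_lt`).  NOT a statement of the manuscript. -/
theorem campaignW46MohWindowShadeTerminalCentreStable_holds :
    CampaignW46MohWindowShadeTerminalCentreStable p K σ :=
  fun S _j hj b hbj hbN s hr hord hlo hhi hS =>
    ⟨CampaignW46.MohWindowShadeTerminalCentres.ordZero_step_eq p hj b hbj hbN s hr hord hlo hhi hS,
      CampaignW46.MohWindowShadeTerminalCentres.shade_step_eq_zero p hj b hbj hbN s hr hord hlo hhi hS,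
      CampaignW46.MohWindowShadeTerminalCentres.isEquimultiplePoint_iff p hj b hbj hbN s hr hord hlo
        hhi hS,
      fun hminj =>
        CampaignW46.MohWindowShadeTerminalCentres.degree_step_r_lt p S _ b hbj s hr hord hS hminj⟩

/-- **[OURS · L1 W4.6] `CampaignW46MohWindowShadeTerminalCentreTerminates` holds** (closer; proof =
`CampaignW46.MohWindowShadeTerminalCentresExit.length_le_of_minimalCentres`).  NOT a statement of the
manuscript. -/
theorem campaignW46MohWindowShadeTerminalCentreTerminates_holds :
    CampaignW46MohWindowShadeTerminalCentreTerminates p K σ :=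
  fun s S j b hj hb hbN hstep hS hmin hclean hr hord hlo hhi _N heq =>
    CampaignW46.MohWindowShadeTerminalCentresExit.length_le_of_minimalCentres p s S j b hj hb hbN
      hstep hS hmin hclean hr hord hlo hhi heq

end Centres

/-- **[OURS · L1 W4.6] `CampaignW46MohWindowShadeFixedPointInWindow` holds** over every field of
characteristic `2` (closer; proof = `CampaignW46.MohWindowShadeFixedPoint.exists_fixed_point_in_window`).
NOT a statement of the manuscript. -/
theorem campaignW46MohWindowShadeFixedPointInWindow_holds (K : Type*) [Field K] [DecidableEq K]
    [CharP K 2] : CampaignW46MohWindowShadeFixedPointInWindow K :=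
  CampaignW46.MohWindowShadeFixedPoint.exists_fixed_point_in_window K


/-! ## v2 (gen 2, APPEND-ONLY): the two-cycle and the no-measure predicates (statement file v3/v4) -/

/-- **[OURS · L1 W4.6] `CampaignW46MohWindowShadeTwoCycleInWindow` holds** for every prime `p` over every
field of characteristic `p` (closer; proof = `CampaignW46.MohWindowShadeCycle.exists_two_cycle_in_window`).
NOT a statement of the manuscript. -/
theorem campaignW46MohWindowShadeTwoCycleInWindow_holds (p : ℕ) [Fact p.Prime] (K : Type*) [Field K]
    [DecidableEq K] [CharP K p] : CampaignW46MohWindowShadeTwoCycleInWindow p K :=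
  CampaignW46.MohWindowShadeCycle.exists_two_cycle_in_window p K

/-- **[OURS · L1 W4.6] `CampaignW46MohWindowShadeNoPointMeasure` holds** for every prime `p` over every
field of characteristic `p` (closer; proof = `CampaignW46.MohWindowShadeNoInvariant.no_nat_measure`).
NOT a statement of the manuscript. -/
theorem campaignW46MohWindowShadeNoPointMeasure_holds (p : ℕ) [Fact p.Prime] (K : Type*) [Field K]
    [DecidableEq K] [CharP K p] : CampaignW46MohWindowShadeNoPointMeasure p K :=
  CampaignW46.MohWindowShadeNoInvariant.no_nat_measure p K

end Summit.ResolutionOfSingularities.ResolutionOfSingularities.Theorems
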